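import Summits.Ventures.Crystal3D.Theorems.StickyWulffConstantGenericWallFloorCoreResidualWide
import Summits.Ventures.Crystal3D.Theorems.StickyWulffConstantGenericWallFloorStackLedgerLocalWordWide
import HarnessLib

/-!
# The WIDE SEPARATED class of lane G: two-grain stack ledgers with tilted verticals at full charge, as a named class
# (crux `GenericWallFloor`, stmt-Ventures-19480, line `WallLedgerG`)

HONEST FRAMING. Venture `Summits/Ventures/Crystal3D` (cell `crystal3d-full`), helper `--supports` the crux `GenericWallFloor`
of `route-Ventures-StickyWulffConstant`, REGISTERED line `WallLedgerG`, open stub `stub_twoSlabAdhesion`.  BOOKKEEPING ONLY;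
F-C1 not moved; NOT the crux: `ExactOnly`(C12-55) [E1] and `StarPairFar` [certified] stay BY NAME.
* `SeparatedWideAt A₁ A₂` — SOME wide-tilted steep slot pair (`z₁`, `u₁`; `z₂`, `u₂`; `‖z₁ − e₃‖, ‖z₂ + e₃‖ ≤ 1/3`) with enough
  flux (`√2|⟪A₁u₁,e₃⟫| + √2|⟪A₂u₂,e₃⟫| ≥ 2`) whose two STACK-FRAME sets are never co-axial (the hypothesis `hsep` of
  `twoSlabAdhesion_stackLedger_local_sep_wide`, p632134); **`genericWallFloorAt_of_separatedWideAt`**: such pairs satisfy the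
  crux's matrix `GenericWallFloorAt A₁ t₁ A₂ t₂` (`c₀ = 1`) for all translations, modulo `ExactOnly`(C12-55) and `StarPairFar`.
* The two-sided WORD cells of `…StackLedgerLocalWordWide` are literally sub-cases: `separatedWideAt_of_word` (`|κ| ≥ 2`, in-plane
  slots at both ends), `separatedWideAt_of_wordTwo`, `separatedWideAt_of_wordFarTwo` (p2 g4's `(1,0)` / `(0,1)` cells); and p2's
  ray-SEPARATED pairs (`¬ RayAlignedAt`, `…OfCore`) are the sub-case `z₁ = e₃`, `z₂ = −e₃` (`separatedWideAt_of_chainFrames_sep`,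
  `separatedWideAt_of_not_rayAlignedAt`).
So the seat's `Σ27` census (`calc/tilt_coverage_k3_wide.out`: two-sided cells reach `c₀ = 1` on `97 %` of Haar `Σ27` orientations,
record `76 %` — evidence, not kernel) is a statement about ONE named class; the residual of record subtracting it is
`…RegisteredResidualWide`.  WHAT THIS IS NOT: any census in the kernel, or the residual; F-C1 not moved.
-/

noncomputable section

namespace Summit.Ventures.Crystal3D.Theorems

open Summit.Ventures.Crystal3D Finset
open Literature.MathematicalPhysics.StatisticalMechanics (fccStacking barlowStacking IsHaggSeq)
open scoped InnerProductSpace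

/-- **The WIDE SEPARATED class** (`SeparatedWideAt A₁ A₂`): unit verticals `z₁`, `z₂` with `‖z₁ − e₃‖ ≤ 1/3`,
`‖z₂ + e₃‖ ≤ 1/3`, a `z₁`-steep slot `u₁` of grain 1 and a `z₂`-steep slot `u₂` of grain 2 with flux
`√2|⟪A₁u₁,e₃⟫| + √2|⟪A₂u₂,e₃⟫| ≥ 2`, such that NO frame of a sound well-formed stack over `(A₁, u₁, 0)` (vertical `z₁`)
is co-axial with a frame of a sound well-formed stack over `(A₂, u₂, 0)` (vertical `z₂`). -/
def SeparatedWideAt (A₁ A₂ : EuclideanSpace ℝ (Fin 3) ≃ₗᵢ[ℝ] EuclideanSpace ℝ (Fin 3)) : Prop :=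
  ∃ (z₁ z₂ u₁ u₂ : EuclideanSpace ℝ (Fin 3)), ‖z₁‖ = 1 ∧ ‖z₁ - EuclideanSpace.single (2 : Fin 3) (1 : ℝ)‖ ≤ 1 / 3 ∧
    ‖z₂‖ = 1 ∧ ‖z₂ + EuclideanSpace.single (2 : Fin 3) (1 : ℝ)‖ ≤ 1 / 3 ∧
    u₁ ∈ fccSlots ∧ Real.sqrt 2 / 2 ≤ ⟪A₁ u₁, z₁⟫_ℝ ∧ u₂ ∈ fccSlots ∧ Real.sqrt 2 / 2 ≤ ⟪A₂ u₂, z₂⟫_ℝ ∧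
    2 ≤ Real.sqrt 2 * |⟪A₁ u₁, EuclideanSpace.single (2 : Fin 3) (1 : ℝ)⟫_ℝ| +
      Real.sqrt 2 * |⟪A₂ u₂, EuclideanSpace.single (2 : Fin 3) (1 : ℝ)⟫_ℝ| ∧
    ∀ stk₁ : List WalkEntry, StackSound z₁ stk₁ → StackWF z₁ stk₁ → stk₁.getLast? = some ⟨A₁, u₁, 0⟩ →
    ∀ e₁ ∈ stk₁,
    ∀ stk₂ : List WalkEntry, StackSound z₂ stk₂ → StackWF z₂ stk₂ → stk₂.getLast? = some ⟨A₂, u₂, 0⟩ →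
    ∀ e₂ ∈ stk₂,
      ¬ ∃ (L : EuclideanSpace ℝ (Fin 3) ≃ₗᵢ[ℝ] EuclideanSpace ℝ (Fin 3)) (s₁ s₂ : EuclideanSpace ℝ (Fin 3))
          (σ σ' : ℤ → ℤ), IsHaggSeq σ ∧ IsHaggSeq σ' ∧
        e₁.frame '' fccStacking 1 (Real.sqrt (2 / 3)) ⊆
          (fun p => L p + s₁) '' barlowStacking 1 (Real.sqrt (2 / 3)) σ ∧
        e₂.frame '' fccStacking 1 (Real.sqrt (2 / 3)) ⊆
          (fun p => L p + s₂) '' barlowStacking 1 (Real.sqrt (2 / 3)) σ'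

open scoped Classical in
/-- **Pairs in the wide separated class satisfy the crux's matrix** (`c₀ = 1`), modulo `ExactOnly`(C12-55) and `StarPairFar`:
`twoSlabAdhesion_stackLedger_local_sep_wide` on the two stack-frame sets, `genericWallFloorAtCharge_of_ledger`, and the flux. -/
theorem genericWallFloorAt_of_separatedWideAt
    {s₀ : EuclideanSpace ℝ (Fin 3)} (hs₀ : s₀ ∈ fccSlots)
    (hcert : ExactOnly 0 (fccSlots.filter fun w => 0 < ⟪w, s₀⟫_ℝ)) (hfar : StarPairFar)
    {A₁ A₂ : EuclideanSpace ℝ (Fin 3) ≃ₗᵢ[ℝ] EuclideanSpace ℝ (Fin 3)} (h : SeparatedWideAt A₁ A₂)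
    (t₁ t₂ : EuclideanSpace ℝ (Fin 3)) : GenericWallFloorAt A₁ t₁ A₂ t₂ := by
  obtain ⟨z₁, z₂, u₁, u₂, hz₁, hze₁, hz₂, hze₂, hu₁, hsteep₁, hu₂, hsteep₂, hflux, hsep⟩ := h
  exact genericWallFloorAt_of_charge_one (genericWallFloorAtCharge_mono (by linarith only [hflux])
    (genericWallFloorAtCharge_of_ledger _ A₁ t₁ A₂ t₂
      (twoSlabAdhesion_stackLedger_local_sep_wide hs₀ hcert (doubleStarCoaxialAt_of_starPairFar hfar)
        (capPairCoaxial_of_starPairFar hfar) A₁ t₁ A₂ t₂ hz₁ hze₁ hz₂ hze₂ hu₁ hsteep₁ hu₂ hsteep₂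
        {F | ∃ stk : List WalkEntry, StackSound z₁ stk ∧ StackWF z₁ stk ∧ stk.getLast? = some ⟨A₁, u₁, 0⟩ ∧
          ∃ e ∈ stk, e.frame = F}
        {F | ∃ stk : List WalkEntry, StackSound z₂ stk ∧ StackWF z₂ stk ∧ stk.getLast? = some ⟨A₂, u₂, 0⟩ ∧
          ∃ e ∈ stk, e.frame = F}
        (fun stk hS hW hl e he => ⟨stk, hS, hW, hl, e, he, rfl⟩)
        (fun stk hS hW hl e he => ⟨stk, hS, hW, hl, e, he, rfl⟩)
        (fun _ ⟨stk₁, hS₁, hW₁, hl₁, e₁, he₁, hF₁⟩ _ ⟨stk₂, hS₂, hW₂, hl₂, e₂, he₂, hF₂⟩ => by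
          rw [← hF₁, ← hF₂]
          exact hsep stk₁ hS₁ hW₁ hl₁ e₁ he₁ stk₂ hS₂ hW₂ hl₂ e₂ he₂))))

/-- **The two-sided word cell is a sub-case**: chain pair `A₂·Λ₀ = (wordFrame A₁ κ)·Λ₀` with `|κ| ≥ 2`, wide-tilted steep slots
`u₁` IN the first and `u₂` IN the last mirror plane, enough flux ⇒ `SeparatedWideAt A₁ A₂` (`not_coaxial_of_word`). -/
theorem separatedWideAt_of_word
    {A₁ A₂ : EuclideanSpace ℝ (Fin 3) ≃ₗᵢ[ℝ] EuclideanSpace ℝ (Fin 3)}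
    {z₁ : EuclideanSpace ℝ (Fin 3)} (hz₁ : ‖z₁‖ = 1) (hze₁ : ‖z₁ - EuclideanSpace.single (2 : Fin 3) (1 : ℝ)‖ ≤ 1 / 3)
    {z₂ : EuclideanSpace ℝ (Fin 3)} (hz₂ : ‖z₂‖ = 1) (hze₂ : ‖z₂ + EuclideanSpace.single (2 : Fin 3) (1 : ℝ)‖ ≤ 1 / 3)
    {u₁ : EuclideanSpace ℝ (Fin 3)} (hu₁ : u₁ ∈ fccSlots) (hsteep₁ : Real.sqrt 2 / 2 ≤ ⟪A₁ u₁, z₁⟫_ℝ)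
    {u₂ : EuclideanSpace ℝ (Fin 3)} (hu₂ : u₂ ∈ fccSlots) (hsteep₂ : Real.sqrt 2 / 2 ≤ ⟪A₂ u₂, z₂⟫_ℝ)
    (hflux : 2 ≤ Real.sqrt 2 * |⟪A₁ u₁, EuclideanSpace.single (2 : Fin 3) (1 : ℝ)⟫_ℝ| +
      Real.sqrt 2 * |⟪A₂ u₂, EuclideanSpace.single (2 : Fin 3) (1 : ℝ)⟫_ℝ|)
    (κ : List (EuclideanSpace ℝ (Fin 3)))
    (hκl : ∀ μ ∈ κ, ‖μ‖ = 1 ∧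
      ∀ w ∈ fccSlots, ⟪w, μ⟫_ℝ = 0 ∨ ⟪w, μ⟫_ℝ = Real.sqrt (2 / 3) ∨ ⟪w, μ⟫_ℝ = -Real.sqrt (2 / 3))
    (hκc : List.IsChain (fun μ μ' => ⟪μ, μ'⟫_ℝ = 1 / 3 ∨ ⟪μ, μ'⟫_ℝ = -1 / 3) κ) (hκ2 : 2 ≤ κ.length)
    (hA₂ : A₂ '' fccStacking 1 (Real.sqrt (2 / 3)) = (wordFrame A₁ κ) '' fccStacking 1 (Real.sqrt (2 / 3)))
    (hfirst : ∀ μ, κ.getLast? = some μ → ⟪u₁, μ⟫_ℝ = 0)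
    (hlast : ∀ μ, κ.head? = some μ → ⟪A₂ u₂, wordFrame A₁ κ μ⟫_ℝ = 0) :
    SeparatedWideAt A₁ A₂ :=
  ⟨z₁, z₂, u₁, u₂, hz₁, hze₁, hz₂, hze₂, hu₁, hsteep₁, hu₂, hsteep₂, hflux,
    fun _ hS₁ hW₁ hl₁ _ he₁ _ hS₂ hW₂ hl₂ _ he₂ =>
      not_coaxial_of_word κ hκl hκc hκ2 hA₂ hfirst hlast hS₁ hW₁ hl₁ hS₂ hW₂ hl₂ he₁ he₂⟩

/-- **The near-level-two word cell is a sub-case** (p2 g4's `(1,0)` cell, wide tilt; `not_coaxial_of_word_two`). -/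
theorem separatedWideAt_of_wordTwo
    {A₁ A₂ : EuclideanSpace ℝ (Fin 3) ≃ₗᵢ[ℝ] EuclideanSpace ℝ (Fin 3)}
    {z₁ : EuclideanSpace ℝ (Fin 3)} (hz₁ : ‖z₁‖ = 1) (hze₁ : ‖z₁ - EuclideanSpace.single (2 : Fin 3) (1 : ℝ)‖ ≤ 1 / 3)
    {z₂ : EuclideanSpace ℝ (Fin 3)} (hz₂ : ‖z₂‖ = 1) (hze₂ : ‖z₂ + EuclideanSpace.single (2 : Fin 3) (1 : ℝ)‖ ≤ 1 / 3)
    {u₁ : EuclideanSpace ℝ (Fin 3)} (hu₁ : u₁ ∈ fccSlots) (hsteep₁ : Real.sqrt 2 / 2 ≤ ⟪A₁ u₁, z₁⟫_ℝ)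
    {u₂ : EuclideanSpace ℝ (Fin 3)} (hu₂ : u₂ ∈ fccSlots) (hsteep₂ : Real.sqrt 2 / 2 ≤ ⟪A₂ u₂, z₂⟫_ℝ)
    (hflux : 2 ≤ Real.sqrt 2 * |⟪A₁ u₁, EuclideanSpace.single (2 : Fin 3) (1 : ℝ)⟫_ℝ| +
      Real.sqrt 2 * |⟪A₂ u₂, EuclideanSpace.single (2 : Fin 3) (1 : ℝ)⟫_ℝ|)
    (κ₀ : List (EuclideanSpace ℝ (Fin 3))) (μ₂ μ₁ : EuclideanSpace ℝ (Fin 3)) (hκ₀ : κ₀ ≠ [])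
    (hκl : ∀ μ ∈ κ₀ ++ [μ₂, μ₁], ‖μ‖ = 1 ∧
      ∀ w ∈ fccSlots, ⟪w, μ⟫_ℝ = 0 ∨ ⟪w, μ⟫_ℝ = Real.sqrt (2 / 3) ∨ ⟪w, μ⟫_ℝ = -Real.sqrt (2 / 3))
    (hκc : List.IsChain (fun μ μ' => ⟪μ, μ'⟫_ℝ = 1 / 3 ∨ ⟪μ, μ'⟫_ℝ = -1 / 3) (κ₀ ++ [μ₂, μ₁]))
    (hA₂ : A₂ '' fccStacking 1 (Real.sqrt (2 / 3)) = (wordFrame A₁ (κ₀ ++ [μ₂, μ₁])) '' fccStacking 1 (Real.sqrt (2 / 3)))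
    (hsecond : ∀ n₁ : EuclideanSpace ℝ (Fin 3), (n₁ = A₁ μ₁ ∨ n₁ = -A₁ μ₁) → ⟪A₁ u₁, n₁⟫_ℝ = Real.sqrt (2 / 3) →
      ∀ q ∈ fccSlots, 0 < ⟪twinFrame A₁ n₁ q, n₁⟫_ℝ →
        (∀ q' ∈ fccSlots, 0 < ⟪twinFrame A₁ n₁ q', n₁⟫_ℝ → ⟪twinFrame A₁ n₁ q', z₁⟫_ℝ ≤ ⟪twinFrame A₁ n₁ q, z₁⟫_ℝ) →
        (twinFrame A₁ n₁).symm ((2 * Real.sqrt (2 / 3)) • twinFrame A₁ n₁ q - n₁) ≠ μ₂ ∧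
        (twinFrame A₁ n₁).symm ((2 * Real.sqrt (2 / 3)) • twinFrame A₁ n₁ q - n₁) ≠ -μ₂)
    (hlast : ∀ μ, (κ₀ ++ [μ₂, μ₁]).head? = some μ → ⟪A₂ u₂, wordFrame A₁ (κ₀ ++ [μ₂, μ₁]) μ⟫_ℝ = 0) :
    SeparatedWideAt A₁ A₂ :=
  ⟨z₁, z₂, u₁, u₂, hz₁, hze₁, hz₂, hze₂, hu₁, hsteep₁, hu₂, hsteep₂, hflux,
    fun _ hS₁ hW₁ hl₁ _ he₁ _ hS₂ hW₂ hl₂ _ he₂ =>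
      not_coaxial_of_word_two κ₀ μ₂ μ₁ hκ₀ hκl hκc hA₂ hsecond hlast hS₁ hW₁ hl₁ hS₂ hW₂ hl₂ he₁ he₂⟩

/-- **The far-level-two word cell is a sub-case** (p2 g4's `(0,1)` cell, wide tilt; `not_coaxial_of_word_farTwo`). -/
theorem separatedWideAt_of_wordFarTwo
    {A₁ A₂ : EuclideanSpace ℝ (Fin 3) ≃ₗᵢ[ℝ] EuclideanSpace ℝ (Fin 3)}
    {z₁ : EuclideanSpace ℝ (Fin 3)} (hz₁ : ‖z₁‖ = 1) (hze₁ : ‖z₁ - EuclideanSpace.single (2 : Fin 3) (1 : ℝ)‖ ≤ 1 / 3)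
    {z₂ : EuclideanSpace ℝ (Fin 3)} (hz₂ : ‖z₂‖ = 1) (hze₂ : ‖z₂ + EuclideanSpace.single (2 : Fin 3) (1 : ℝ)‖ ≤ 1 / 3)
    {u₁ : EuclideanSpace ℝ (Fin 3)} (hu₁ : u₁ ∈ fccSlots) (hsteep₁ : Real.sqrt 2 / 2 ≤ ⟪A₁ u₁, z₁⟫_ℝ)
    {u₂ : EuclideanSpace ℝ (Fin 3)} (hu₂ : u₂ ∈ fccSlots) (hsteep₂ : Real.sqrt 2 / 2 ≤ ⟪A₂ u₂, z₂⟫_ℝ)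
    (hflux : 2 ≤ Real.sqrt 2 * |⟪A₁ u₁, EuclideanSpace.single (2 : Fin 3) (1 : ℝ)⟫_ℝ| +
      Real.sqrt 2 * |⟪A₂ u₂, EuclideanSpace.single (2 : Fin 3) (1 : ℝ)⟫_ℝ|)
    (μk μk1 : EuclideanSpace ℝ (Fin 3)) (κ₁ : List (EuclideanSpace ℝ (Fin 3))) (hκ₁ : κ₁ ≠ [])
    (hκl : ∀ μ ∈ μk :: μk1 :: κ₁, ‖μ‖ = 1 ∧
      ∀ w ∈ fccSlots, ⟪w, μ⟫_ℝ = 0 ∨ ⟪w, μ⟫_ℝ = Real.sqrt (2 / 3) ∨ ⟪w, μ⟫_ℝ = -Real.sqrt (2 / 3))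
    (hκc : List.IsChain (fun μ μ' => ⟪μ, μ'⟫_ℝ = 1 / 3 ∨ ⟪μ, μ'⟫_ℝ = -1 / 3) (μk :: μk1 :: κ₁))
    (hA₂ : A₂ '' fccStacking 1 (Real.sqrt (2 / 3)) =
      (wordFrame A₁ (μk :: μk1 :: κ₁)) '' fccStacking 1 (Real.sqrt (2 / 3)))
    (hfirst : ∀ μ, κ₁.getLast? = some μ → ⟪u₁, μ⟫_ℝ = 0)
    (hsecond : ∀ n₁ : EuclideanSpace ℝ (Fin 3),
      (n₁ = wordFrame A₁ (μk :: μk1 :: κ₁) μk ∨ n₁ = -wordFrame A₁ (μk :: μk1 :: κ₁) μk) →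
      ⟪A₂ u₂, n₁⟫_ℝ = Real.sqrt (2 / 3) →
      ∀ q ∈ fccSlots, 0 < ⟪twinFrame A₂ n₁ q, n₁⟫_ℝ →
        (∀ q' ∈ fccSlots, 0 < ⟪twinFrame A₂ n₁ q', n₁⟫_ℝ → ⟪twinFrame A₂ n₁ q', z₂⟫_ℝ ≤ ⟪twinFrame A₂ n₁ q, z₂⟫_ℝ) →
        (wordFrame A₁ (μk :: μk1 :: κ₁)).symm
            (A₂ ((twinFrame A₂ n₁).symm ((2 * Real.sqrt (2 / 3)) • twinFrame A₂ n₁ q - n₁))) ≠ μk1 ∧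
        (wordFrame A₁ (μk :: μk1 :: κ₁)).symm
            (A₂ ((twinFrame A₂ n₁).symm ((2 * Real.sqrt (2 / 3)) • twinFrame A₂ n₁ q - n₁))) ≠ -μk1) :
    SeparatedWideAt A₁ A₂ :=
  ⟨z₁, z₂, u₁, u₂, hz₁, hze₁, hz₂, hze₂, hu₁, hsteep₁, hu₂, hsteep₂, hflux,
    fun _ hS₁ hW₁ hl₁ _ he₁ _ hS₂ hW₂ hl₂ _ he₂ =>
      not_coaxial_of_word_farTwo μk μk1 κ₁ hκ₁ hκl hκc hA₂ hfirst hsecond hS₁ hW₁ hl₁ hS₂ hW₂ hl₂ he₁ he₂⟩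

/-- **p2's ray-SEPARATED pairs are a sub-case** (`z₁ = e₃`, `z₂ = −e₃`): a steep slot pair whose forced-ray frame sets
`chainFrames e₃ A₁ u₁`, `chainFrames (−e₃) A₂ u₂` are never co-axial gives `SeparatedWideAt A₁ A₂`. -/
theorem separatedWideAt_of_chainFrames_sep
    {A₁ A₂ : EuclideanSpace ℝ (Fin 3) ≃ₗᵢ[ℝ] EuclideanSpace ℝ (Fin 3)}
    {u₁ : EuclideanSpace ℝ (Fin 3)} (hu₁ : u₁ ∈ fccSlots)
    (hsteep₁ : Real.sqrt 2 / 2 ≤ ⟪A₁ u₁, EuclideanSpace.single (2 : Fin 3) (1 : ℝ)⟫_ℝ)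
    {u₂ : EuclideanSpace ℝ (Fin 3)} (hu₂ : u₂ ∈ fccSlots)
    (hsteep₂ : ⟪A₂ u₂, EuclideanSpace.single (2 : Fin 3) (1 : ℝ)⟫_ℝ ≤ -(Real.sqrt 2 / 2))
    (hsep : ∀ F₁ ∈ chainFrames (EuclideanSpace.single (2 : Fin 3) (1 : ℝ)) A₁ u₁,
      ∀ F₂ ∈ chainFrames (-EuclideanSpace.single (2 : Fin 3) (1 : ℝ)) A₂ u₂,
      ¬ ∃ (L : EuclideanSpace ℝ (Fin 3) ≃ₗᵢ[ℝ] EuclideanSpace ℝ (Fin 3))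
        (s₁ s₂ : EuclideanSpace ℝ (Fin 3)) (σ σ' : ℤ → ℤ), IsHaggSeq σ ∧ IsHaggSeq σ' ∧
        F₁ '' fccStacking 1 (Real.sqrt (2 / 3)) ⊆ (fun p => L p + s₁) '' barlowStacking 1 (Real.sqrt (2 / 3)) σ ∧
        F₂ '' fccStacking 1 (Real.sqrt (2 / 3)) ⊆ (fun p => L p + s₂) '' barlowStacking 1 (Real.sqrt (2 / 3)) σ') :
    SeparatedWideAt A₁ A₂ := by
  have he : ‖(EuclideanSpace.single (2 : Fin 3) (1 : ℝ) : EuclideanSpace ℝ (Fin 3))‖ = 1 := by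
    rw [PiLp.norm_single, norm_one]
  have hs2 : 0 < Real.sqrt 2 := Real.sqrt_pos.2 (by norm_num)
  have hss : Real.sqrt 2 * Real.sqrt 2 = 2 := Real.mul_self_sqrt (by norm_num)
  refine ⟨EuclideanSpace.single (2 : Fin 3) (1 : ℝ), -EuclideanSpace.single (2 : Fin 3) (1 : ℝ), u₁, u₂, he, by simp,
    by rw [norm_neg, he], by simp, hu₁, hsteep₁, hu₂, by rw [inner_neg_right]; linarith, ?_,
    fun stk₁ hS₁ hW₁ hl₁ e₁ he₁ stk₂ hS₂ hW₂ hl₂ e₂ he₂ =>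
      hsep _ (frame_mem_chainFrames_of_stack hS₁ hW₁ hl₁ e₁ he₁) _ (frame_mem_chainFrames_of_stack hS₂ hW₂ hl₂ e₂ he₂)⟩
  have h₁ : Real.sqrt 2 / 2 ≤ |⟪A₁ u₁, EuclideanSpace.single (2 : Fin 3) (1 : ℝ)⟫_ℝ| := hsteep₁.trans (le_abs_self _)
  have h₂ : Real.sqrt 2 / 2 ≤ |⟪A₂ u₂, EuclideanSpace.single (2 : Fin 3) (1 : ℝ)⟫_ℝ| := by
    rw [abs_of_nonpos (by linarith [hsteep₂, hs2])]; linarith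
  nlinarith [mul_le_mul_of_nonneg_left h₁ hs2.le, mul_le_mul_of_nonneg_left h₂ hs2.le]

/-- The complement of p2's `RayAlignedAt` lies inside the wide separated class. -/
theorem separatedWideAt_of_not_rayAlignedAt {A₁ A₂ : EuclideanSpace ℝ (Fin 3) ≃ₗᵢ[ℝ] EuclideanSpace ℝ (Fin 3)}
    (h : ¬ RayAlignedAt A₁ A₂) : SeparatedWideAt A₁ A₂ := by
  unfold RayAlignedAt at h
  push Not at h
  obtain ⟨u₁, hu₁, hsteep₁, u₂, hu₂, hsteep₂, hsep⟩ := h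
  exact separatedWideAt_of_chainFrames_sep hu₁ hsteep₁ hu₂ hsteep₂ fun F₁ hF₁ F₂ hF₂ hco => by
    obtain ⟨L, s₁, s₂, σ, σ', hσ, hσ', h₁, h₂⟩ := hco
    exact hsep F₁ hF₁ F₂ hF₂ L s₁ s₂ σ σ' hσ hσ' h₁ h₂

end Summit.Ventures.Crystal3D.Theorems

end
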